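import Summits.BirchSwinnertonDyer.BirchSwinnertonDyer.Theorems.EdixhovenFibreFiveSevenStarredOptimalManinUnitFiveSevenHcorPrimeLevel
import Literature.NumberTheory.Automorphic.UnboundedDenominatorsInvariantHomLocalCyclic
import Literature.NumberTheory.Automorphic.UnboundedDenominatorsCommutatorFiniteIndex
import Mathlib.Data.Nat.Squarefree
import HarnessLib

set_option autoImplicit false
-- the sub-problem namespace `Summit.BirchSwinnertonDyer.BirchSwinnertonDyer` duplicates a component by design (D-0017)
set_option linter.dupNamespace false

/-!
# K★ line `cdt_thm1`, stub `stub_hcor_invariant`: the invariant form of CDT Cor. 4.5.3 AT SQUAREFREE LEVEL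

Crux `StarredOptimalManinUnitFiveSeven` (stmt-BirchSwinnertonDyer-22226); skeleton v17 has the single stub
`stub_hcor_invariant` (all `N`).  This file proves it for SQUAREFREE `N`:

* `cor453_invariant_form_squarefree` — **for squarefree `N` and every finite commutative `Q`, every
  `SL₂(ℤ)`-conjugation-invariant `θ : Γ(N) → Q` is trivial on `Γ(12N)`** (equivalently `[SL₂(ℤ), Γ(N)] ⊇ Γ(12N)`;
  Beyl's exact level is `lcm(N,12)` [Beyl1986]).

Proof: prime by prime in `|Q|` (exponent form); the local condition for `Γ(N/d)` is established for every `d ∣ N` by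
induction on `d`, gluing (`UnboundedDenominatorsInvariantHomGluing`, cross-commutators die) the local certificate at
one prime `p ∣ d` — cyclic (`Γ(N/p)·⟨T⟩`, split or non-split Cartan) or, for `2`-power targets at odd `p`, the
odd-index dicyclic normaliser of the cell bsd-f2-manin (`ManinLocalTwoThree.SL2ZModOddPrime.exists_dicyclic_oddIndex`)
with the dicyclic central-extension lemma — to the induction hypothesis for `d/p`.  Prime-power levels (`p² ∣ N`) are
NOT treated (the hard residue: `M(SL₂(ℤ/p^e))`, [Beyl1986]); the stub stays open; K★ / Manin / BSD are not proved.
-/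

open scoped MatrixGroups commutatorElement

namespace Summit.BirchSwinnertonDyer.BirchSwinnertonDyer.Theorems

namespace HcorSquarefree

open CongruenceSubgroup Matrix.SpecialLinearGroup ModularGroup
open Literature.NumberTheory.Automorphic.UnboundedDenominators
open Literature.NumberTheory.EllipticCurves.ModularForms (specialLinearGroup_map_surjective)
open Summit.BirchSwinnertonDyer.BirchSwinnertonDyer.Theorems.ManinLocalTwoThree.SL2ZModOddPrime
  (exists_dicyclic_oddIndex)

variable {Q : Type*} [CommGroup Q]

/-- `Γ(L) ≤ Γ(M)` for `M ∣ L`. [folklore] -/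
private theorem Gamma_le_Gamma_of_dvd₄ {M L : ℕ} (h : M ∣ L) : Gamma L ≤ Gamma M := by
  intro γ hγ
  obtain ⟨h00, h01, h10, h11⟩ := Gamma_mem.mp hγ
  have cast_eq : ∀ a : ℤ, ((a : ZMod L).cast : ZMod M) = (a : ZMod M) := fun a ↦
    ZMod.cast_intCast h a
  rw [Gamma_mem]
  refine ⟨?_, ?_, ?_, ?_⟩
  · rw [← cast_eq, h00, ZMod.cast_one h]
  · rw [← cast_eq, h01, ZMod.cast_zero]
  · rw [← cast_eq, h10, ZMod.cast_zero]
  · rw [← cast_eq, h11, ZMod.cast_one h]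

/-- **Dicyclic certificate at a coprime factor.**  Let `N = m'·m` (`gcd(m', m) = 1`), `θ : Γ(N) → Q`
`SL₂(ℤ)`-invariant with `θ(x)^e = 1`, and let `a, b ∈ SL₂(ℤ/m)` satisfy the dicyclic relations
(`b a b⁻¹ = a⁻¹`, `b² = a^k`, `a^{2j} = 1 ⇒ k ∣ j`) with `[SL₂(ℤ/m) : ⟨a, b⟩]` prime to `e`.  Then `θ` kills
`Γ(N) ∩ ([Γ(m'), Γ(m')]·K_θ)`. [cite: CalegariDimitrovTang2025, Corollary 4.5.3] [cite: Huppert1967, Satz V.25.3] -/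
theorem local_Gamma_of_dicyclic {m m' : ℕ} [NeZero m] [NeZero m'] (hmm : m'.Coprime m)
    (θ : Gamma (m' * m) →* Q)
    (hθ : ∀ (g x : SL(2, ℤ)) (hx : x ∈ Gamma (m' * m)) (hgx : g * x * g⁻¹ ∈ Gamma (m' * m)),
      θ ⟨g * x * g⁻¹, hgx⟩ = θ ⟨x, hx⟩)
    {e : ℕ} (he : ∀ x : Gamma (m' * m), θ x ^ e = 1)
    {a b : SL(2, ZMod m)} {k : ℕ} (hab : b * a * b⁻¹ = a⁻¹) (hb2 : b ^ 2 = a ^ k)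
    (hak : ∀ j : ℕ, a ^ (2 * j) = 1 → k ∣ j)
    (hcop : e.Coprime (Subgroup.closure ({a, b} : Set (SL(2, ZMod m)))).index) :
    ∀ (y : SL(2, ℤ)) (hy : y ∈ Gamma (m' * m)),
      y ∈ ⁅Gamma m', Gamma m'⁆ ⊔ θ.ker.map (Gamma (m' * m)).subtype → θ ⟨y, hy⟩ = 1 := by
  classical
  haveI := ker_map_subtype_normal θ hθ
  haveI := Gamma_normal (m' * m)
  set red := Matrix.SpecialLinearGroup.map (n := Fin 2) (Int.castRingHom (ZMod m)) with hred
  set K : Subgroup SL(2, ℤ) := θ.ker.map (Gamma (m' * m)).subtype with hKdef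
  set π : SL(2, ℤ) →* SL(2, ℤ) ⧸ K := QuotientGroup.mk' K with hπ
  set Z : Subgroup (SL(2, ℤ) ⧸ K) := (Gamma (m' * m)).map π with hZ
  obtain ⟨c, hcm', hc⟩ := exists_mem_Gamma_map_eq hmm a
  obtain ⟨w, hwm', hw⟩ := exists_mem_Gamma_map_eq hmm b
  set D : Subgroup (SL(2, ZMod m)) := Subgroup.closure ({a, b} : Set (SL(2, ZMod m))) with hD
  set X : Subgroup SL(2, ℤ) := D.comap red with hX
  set H : Subgroup SL(2, ℤ) := X ⊓ Gamma m' with hH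
  have hNm' : Gamma (m' * m) ≤ Gamma m' := Gamma_le_Gamma_of_dvd₄ (dvd_mul_right m' m)
  have hNm : Gamma (m' * m) ≤ Gamma m := Gamma_le_Gamma_of_dvd₄ (dvd_mul_left m m')
  have hNH : Gamma (m' * m) ≤ H := by
    intro x hx
    refine Subgroup.mem_inf.mpr ⟨?_, hNm' hx⟩
    rw [hX, Subgroup.mem_comap, (Gamma_mem'.mp (hNm hx) : red x = 1)]
    exact one_mem _
  -- `H = ⟨c, w⟩ · Γ(N)`
  have hcw_le : Subgroup.closure ({c, w} : Set SL(2, ℤ)) ≤ Gamma m' := by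
    rw [Subgroup.closure_le]
    rintro x (rfl | rfl)
    · exact hcm'
    · exact hwm'
  have hmapcw : (Subgroup.closure ({c, w} : Set SL(2, ℤ))).map red = D := by
    rw [MonoidHom.map_closure, Set.image_insert_eq, Set.image_singleton, show red c = a from hc,
      show red w = b from hw]
  have hHeq : H = Subgroup.closure ({c, w} : Set SL(2, ℤ)) ⊔ Gamma (m' * m) := by
    apply le_antisymm
    · intro y hy
      obtain ⟨hyX, hym'⟩ := Subgroup.mem_inf.mp hy
      rw [hX, Subgroup.mem_comap, ← hmapcw] at hyX
      obtain ⟨u, hu, huy⟩ := hyX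
      rw [Subgroup.mem_sup_of_normal_right]
      refine ⟨u, hu, u⁻¹ * y, ?_, by group⟩
      refine mem_Gamma_mul_of_coprime hmm (mul_mem (inv_mem (hcw_le hu)) hym') ?_
      rw [Gamma_mem', map_mul, map_inv, ← hred, huy, inv_mul_cancel]
    · refine sup_le ?_ hNH
      intro u hu
      refine Subgroup.mem_inf.mpr ⟨?_, hcw_le hu⟩
      rw [hX, Subgroup.mem_comap, ← hmapcw]
      exact ⟨u, hu, rfl⟩
  -- the hypotheses of the dicyclic lemma in `SL₂(ℤ)/K_θ`
  have hZc : Z ≤ Subgroup.center (SL(2, ℤ) ⧸ K) := by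
    rintro _ ⟨x, hx, rfl⟩
    exact mk_mem_center_of_mem_Gamma θ hθ hx
  have hmemZ : ∀ x : SL(2, ℤ), x ∈ Gamma m' → red x = 1 → π x ∈ Z := fun x hx1 hx2 ↦
    Subgroup.mem_map_of_mem π (mem_Gamma_mul_of_coprime hmm hx1 (Gamma_mem'.mpr hx2))
  have h1 : π w * π c * (π w)⁻¹ * π c ∈ Z := by
    rw [← map_inv, ← map_mul, ← map_mul, ← map_mul]
    refine hmemZ _ (mul_mem (mul_mem (mul_mem hwm' hcm') (inv_mem hwm')) hcm') ?_
    rw [map_mul, map_mul, map_mul, map_inv, show red c = a from hc, show red w = b from hw, hab,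
      inv_mul_cancel]
  have h2 : π w ^ 2 * (π c ^ k)⁻¹ ∈ Z := by
    rw [← map_pow, ← map_pow, ← map_inv, ← map_mul]
    refine hmemZ _ (mul_mem (pow_mem hwm' _) (inv_mem (pow_mem hcm' _))) ?_
    rw [map_mul, map_inv, map_pow, map_pow, show red c = a from hc, show red w = b from hw, hb2,
      mul_inv_cancel]
  have hord : ∀ i : ℤ, π c ^ (2 * i) ∈ Z → (k : ℤ) ∣ i := by
    intro i hi
    rw [← map_zpow] at hi
    obtain ⟨x, hx, hxe⟩ := hi
    have hmem : c ^ (2 * i) ∈ Gamma (m' * m) := by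
      rw [hπ, QuotientGroup.mk'_eq_mk'] at hxe
      obtain ⟨z, hz, hze⟩ := hxe
      rw [← hze]
      exact mul_mem hx (ker_map_subtype_le θ hz)
    have ha : a ^ (2 * i) = 1 := by
      rw [← hc, ← map_zpow]
      exact Gamma_mem'.mp (hNm hmem)
    have hnat : a ^ (2 * i.natAbs) = 1 := by
      rcases Int.natAbs_eq i with h | h
      · have : (2 * i : ℤ) = ((2 * i.natAbs : ℕ) : ℤ) := by rw [h]; simp
        rw [this, zpow_natCast] at ha; exact ha
      · have : (2 * i : ℤ) = -((2 * i.natAbs : ℕ) : ℤ) := by omega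
        rw [this, zpow_neg, inv_eq_one, zpow_natCast] at ha; exact ha
    exact Int.ofNat_dvd_left.mpr (hak _ hnat)
  -- the local condition for `H`
  have hloc : ∀ (y : SL(2, ℤ)) (hy : y ∈ Gamma (m' * m)),
      y ∈ ⁅H, H⁆ ⊔ θ.ker.map (Gamma (m' * m)).subtype → θ ⟨y, hy⟩ = 1 := by
    intro y hy hyc
    have hπy : π y ∈ Z := Subgroup.mem_map_of_mem π hy
    have hπyc : π y ∈ ⁅Subgroup.closure ({π c, π w} ∪ (Z : Set (SL(2, ℤ) ⧸ K))),
        Subgroup.closure ({π c, π w} ∪ (Z : Set (SL(2, ℤ) ⧸ K)))⁆ := by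
      have hL : Subgroup.closure ({π c, π w} ∪ (Z : Set (SL(2, ℤ) ⧸ K))) = H.map π := by
        rw [Subgroup.closure_union, Subgroup.closure_eq, hHeq, Subgroup.map_sup, MonoidHom.map_closure,
          Set.image_insert_eq, Set.image_singleton]
      rw [hL, ← Subgroup.map_commutator]
      have h3 : y ∈ ⁅H, H⁆ ⊔ K := hyc
      rw [Subgroup.mem_sup_of_normal_right] at h3
      obtain ⟨u, hu, v, hv, rfl⟩ := h3
      refine ⟨u, hu, ?_⟩
      have hv1 : π v = 1 := by
        rw [hπ, QuotientGroup.mk'_apply]; exact (QuotientGroup.eq_one_iff v).mpr hv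
      rw [map_mul, hv1, mul_one]
    have hone :=
      Literature.GroupTheory.SpecificGroups.DicyclicCentral.eq_one_of_mem_of_mem_commutator_closure
        Z hZc (π c) (π w) k h1 h2 hord hπy hπyc
    have hyK : y ∈ K := by rwa [← QuotientGroup.ker_mk' K, MonoidHom.mem_ker]
    obtain ⟨_, h⟩ := (mem_ker_map_subtype_iff θ).mp hyK
    exact h
  -- relative index and transfer
  have htop : (Gamma m').map red = ⊤ := by
    rw [eq_top_iff]
    intro s _
    obtain ⟨d, hd, hds⟩ := exists_mem_Gamma_map_eq hmm s
    exact ⟨d, hd, hds⟩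
  have hidx : H.relIndex (Gamma m') = D.index := by
    rw [hH, Subgroup.inf_relIndex_right, hX, Subgroup.relIndex_comap, htop, Subgroup.relIndex_top_right]
  have hidx0 : H.relIndex (Gamma m') ≠ 0 := by rw [hidx]; exact Subgroup.FiniteIndex.index_ne_zero
  exact local_of_local_of_relIndex_coprime θ hθ H (Gamma m') hNH inf_le_right he hidx0 (hidx ▸ hcop) hloc

/-- **The local certificate at a prime `p ∥ N`** for a prime-power exponent: if `N = m'·p` with `p ∤ m'` and
`θ(x)^{ℓ^a} = 1` (`ℓ` prime), then `θ` kills `Γ(N) ∩ ([Γ(m'), Γ(m')]·K_θ)` — cyclic certificates (`T̄`, split /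
non-split Cartan) or, for `ℓ = 2 < p`, the dicyclic one. [cite: CalegariDimitrovTang2025, Corollary 4.5.3] -/
theorem local_Gamma_prime {p m' ℓ a : ℕ} (hp : p.Prime) (hℓ : ℓ.Prime) [NeZero m'] (hmm : m'.Coprime p)
    (θ : Gamma (m' * p) →* Q)
    (hθ : ∀ (g x : SL(2, ℤ)) (hx : x ∈ Gamma (m' * p)) (hgx : g * x * g⁻¹ ∈ Gamma (m' * p)),
      θ ⟨g * x * g⁻¹, hgx⟩ = θ ⟨x, hx⟩)
    (he : ∀ x : Gamma (m' * p), θ x ^ (ℓ ^ a) = 1) :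
    ∀ (y : SL(2, ℤ)) (hy : y ∈ Gamma (m' * p)),
      y ∈ ⁅Gamma m', Gamma m'⁆ ⊔ θ.ker.map (Gamma (m' * p)).subtype → θ ⟨y, hy⟩ = 1 := by
  haveI : NeZero p := ⟨hp.ne_zero⟩
  haveI : Fact p.Prime := ⟨hp⟩
  have cop_succ : Nat.Coprime p (p + 1) := Nat.coprime_self_add_right.mpr (Nat.coprime_one_right p)
  have cop_pred : Nat.Coprime p (p - 1) := by
    have h : p = 1 + (p - 1) := (Nat.add_sub_cancel' hp.one_le).symm
    conv_lhs => rw [h]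
    exact Nat.coprime_add_self_left.mpr (Nat.coprime_one_left _)
  by_cases hℓp : ℓ = p
  · -- `ℓ = p`: the unipotent `T̄`
    obtain ⟨cbar, hcbar⟩ := exists_zpowers_index_eq_succ_mul_pred hp
    refine local_Gamma_of_zpowers hmm θ hθ he cbar ?_
    rw [hcbar, hℓp]
    exact Nat.Coprime.pow_left _ (Nat.Coprime.mul_right cop_succ cop_pred)
  · have hℓp' : Nat.Coprime ℓ p := (Nat.coprime_primes hℓ hp).mpr hℓp
    by_cases hℓs : ℓ ∣ p + 1
    · rcases hℓ.eq_two_or_odd' with rfl | hℓodd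
      · -- `ℓ = 2 < p`: dicyclic
        have hp2 : p ≠ 2 := fun h ↦ hℓp h.symm
        obtain ⟨a₀, b₀, k, -, hab, hb2, hak, hidx⟩ := exists_dicyclic_oddIndex (q := p) hp2
        exact local_Gamma_of_dicyclic hmm θ hθ he hab hb2 hak
          (Nat.Coprime.pow_left _ (Nat.coprime_two_left.mpr hidx))
      · -- odd `ℓ ∣ p + 1`: non-split Cartan
        have hℓ2 : ℓ ≠ 2 := by rintro rfl; exact (Nat.not_even_iff_odd.mpr hℓodd) even_two
        have hℓd : ¬ ℓ ∣ p - 1 := by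
          intro hd
          have h2 : ℓ ∣ (p + 1) - (p - 1) := Nat.dvd_sub hℓs hd
          have : (p + 1) - (p - 1) = 2 := by have := hp.one_le; omega
          rw [this] at h2
          exact hℓ2 ((Nat.prime_dvd_prime_iff_eq hℓ Nat.prime_two).mp h2)
        obtain ⟨cbar, hcbar⟩ := exists_zpowers_index_eq_mul_pred hp
        refine local_Gamma_of_zpowers hmm θ hθ he cbar ?_
        rw [hcbar]
        exact Nat.Coprime.pow_left _
          (Nat.Coprime.mul_right hℓp' ((Nat.Prime.coprime_iff_not_dvd hℓ).mpr hℓd))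
    · -- `ℓ ∤ p (p+1)`: split Cartan
      obtain ⟨cbar, hcbar⟩ := exists_zpowers_index_eq_mul_succ hp
      refine local_Gamma_of_zpowers hmm θ hθ he cbar ?_
      rw [hcbar]
      exact Nat.Coprime.pow_left _
        (Nat.Coprime.mul_right hℓp' ((Nat.Prime.coprime_iff_not_dvd hℓ).mpr hℓs))

/-- The local certificate at a prime, with the level as a variable. [cite: CalegariDimitrovTang2025, Corollary 4.5.3] -/
theorem local_Gamma_prime' {N p m' ℓ a : ℕ} (hN : N = m' * p) (hp : p.Prime) (hℓ : ℓ.Prime) [NeZero m']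
    (hmm : m'.Coprime p) (θ : Gamma N →* Q)
    (hθ : ∀ (g x : SL(2, ℤ)) (hx : x ∈ Gamma N) (hgx : g * x * g⁻¹ ∈ Gamma N),
      θ ⟨g * x * g⁻¹, hgx⟩ = θ ⟨x, hx⟩)
    (he : ∀ x : Gamma N, θ x ^ (ℓ ^ a) = 1) :
    ∀ (y : SL(2, ℤ)) (hy : y ∈ Gamma N),
      y ∈ ⁅Gamma m', Gamma m'⁆ ⊔ θ.ker.map (Gamma N).subtype → θ ⟨y, hy⟩ = 1 := by
  subst hN
  exact local_Gamma_prime hp hℓ hmm θ hθ he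

/-- **Induction over the divisors of a squarefree level**: for `N = d · c` squarefree and `θ` of prime-power
exponent, `θ` kills `Γ(N) ∩ ([Γ(c), Γ(c)]·K_θ)`. [cite: CalegariDimitrovTang2025, Corollary 4.5.3] -/
theorem local_Gamma_of_squarefree {N ℓ a : ℕ} (hN : Squarefree N) (hℓ : ℓ.Prime) (θ : Gamma N →* Q)
    (hθ : ∀ (g x : SL(2, ℤ)) (hx : x ∈ Gamma N) (hgx : g * x * g⁻¹ ∈ Gamma N),
      θ ⟨g * x * g⁻¹, hgx⟩ = θ ⟨x, hx⟩)
    (he : ∀ x : Gamma N, θ x ^ (ℓ ^ a) = 1) :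
    ∀ (d c : ℕ), N = d * c → ∀ (y : SL(2, ℤ)) (hy : y ∈ Gamma N),
      y ∈ ⁅Gamma c, Gamma c⁆ ⊔ θ.ker.map (Gamma N).subtype → θ ⟨y, hy⟩ = 1 := by
  intro d
  induction d using Nat.strong_induction_on with
  | _ d ih =>
  intro c hdc
  have hN0 : N ≠ 0 := Squarefree.ne_zero hN
  rcases Nat.lt_or_ge 1 d with hd1 | hd1
  swap
  · -- `d ≤ 1`, so `d = 1` and `c = N`
    have hd : d = 1 := by
      rcases Nat.le_one_iff_eq_zero_or_eq_one.mp hd1 with h | h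
      · exfalso; rw [h, zero_mul] at hdc; exact hN0 hdc
      · exact h
    rw [hd, one_mul] at hdc
    subst hdc
    exact local_Gamma_self θ hθ
  · -- `d = p · d'`
    obtain ⟨p, hp, hpd⟩ := Nat.exists_prime_and_dvd (show d ≠ 1 by omega)
    obtain ⟨d', rfl⟩ := hpd
    have hd'lt : d' < p * d' := by
      have hd'0 : 0 < d' := Nat.pos_of_ne_zero (by rintro rfl; simp at hd1)
      exact lt_mul_of_one_lt_left hd'0 hp.one_lt
    -- `N = c · p · d'` with the three factors pairwise coprime (squarefree)
    have hN' : N = c * p * d' := by rw [hdc]; ring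
    have hsq : Squarefree (c * p * d') := hN' ▸ hN
    have hcop : (c * p).Coprime d' := Nat.coprime_of_squarefree_mul hsq
    -- induction hypothesis for `d'`: the local condition for `Γ(c p)`
    have ih₁ := ih d' hd'lt (c * p) (by rw [hN']; ring)
    -- local certificate at `p`: the local condition for `Γ(c d')`
    haveI : NeZero (c * d') := ⟨by
      intro h0; apply hN0; rw [hN']
      rcases mul_eq_zero.mp h0 with h | h <;> simp [h]⟩
    have hcop' : (c * d').Coprime p := by
      have h1 : Squarefree (c * d' * p) := by rw [show c * d' * p = c * p * d' by ring]; exact hsq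
      exact Nat.coprime_of_squarefree_mul h1
    have ih₂ := local_Gamma_prime' (N := N) (by rw [hN']; ring) hp hℓ hcop' θ hθ he
    exact local_Gamma_of_local_Gamma_mul' hN' hcop θ hθ ih₁ ih₂

/-- **The invariant form of CDT Cor. 4.5.3 at squarefree level.**  For every squarefree `N`, every finite
commutative `Q` and every `SL₂(ℤ)`-conjugation-invariant homomorphism `θ : Γ(N) → Q`, `θ` is trivial on `Γ(12N)`.
[cite: CalegariDimitrovTang2025, Corollary 4.5.3] [cite: Beyl1986, Theorem] -/
theorem cor453_invariant_form_squarefree {N : ℕ} (hN : Squarefree N) (Q : Type*) [CommGroup Q] [Finite Q]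
    (θ : Gamma N →* Q)
    (hθ : ∀ (g x : SL(2, ℤ)) (hx : x ∈ Gamma N) (hgx : g * x * g⁻¹ ∈ Gamma N),
      θ ⟨g * x * g⁻¹, hgx⟩ = θ ⟨x, hx⟩) :
    ∀ (x : SL(2, ℤ)) (hx : x ∈ Gamma N), x ∈ Gamma (12 * N) → θ ⟨x, hx⟩ = 1 := by
  haveI : NeZero N := ⟨Squarefree.ne_zero hN⟩
  intro x hx hx12
  set n : ℕ := Nat.card Q with hn
  have hn0 : n ≠ 0 := Nat.card_pos.ne'
  have hinv : ∀ k : ℕ, ∀ (g y : SL(2, ℤ)) (hy : y ∈ Gamma N) (hgy : g * y * g⁻¹ ∈ Gamma N),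
      ((powMonoidHom k).comp θ) ⟨g * y * g⁻¹, hgy⟩ = ((powMonoidHom k).comp θ) ⟨y, hy⟩ := by
    intro k g y hy hgy
    simp only [MonoidHom.comp_apply, hθ g y hy hgy]
  have hpow : ∀ (k : ℕ) (y : Gamma N), ((powMonoidHom k).comp θ) y = θ y ^ k := fun k y ↦ rfl
  -- prime by prime in `|Q|`
  suffices key : ∀ ℓ : ℕ, ℓ.Prime → ℓ ∣ n → θ ⟨x, hx⟩ ^ (ordCompl[ℓ] n) = 1 by
    by_contra hne
    have hord : orderOf (θ ⟨x, hx⟩) ≠ 1 := fun h1 ↦ hne (orderOf_eq_one_iff.mp h1)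
    obtain ⟨ℓ, hℓ, hℓq⟩ := Nat.exists_prime_and_dvd hord
    have hℓn : ℓ ∣ n := hℓq.trans (orderOf_dvd_of_pow_eq_one (hn ▸ pow_card_eq_one'))
    have h1 : ℓ ∣ ordCompl[ℓ] n := hℓq.trans (orderOf_dvd_of_pow_eq_one (key ℓ hℓ hℓn))
    exact hℓ.one_lt.ne' (Nat.Coprime.eq_one_of_dvd (Nat.coprime_ordCompl hℓ hn0) h1)
  intro ℓ hℓ hℓn
  set m : ℕ := ordCompl[ℓ] n with hm_def
  have hnm : ordProj[ℓ] n * m = n := Nat.ordProj_mul_ordCompl_eq_self n ℓ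
  have he : ∀ y : Gamma N, ((powMonoidHom m).comp θ) y ^ (ℓ ^ n.factorization ℓ) = 1 := by
    intro y
    rw [hpow, ← pow_mul, mul_comm, hnm, hn]
    exact pow_card_eq_one'
  suffices h : ((powMonoidHom m).comp θ) ⟨x, hx⟩ = 1 by rwa [hpow] at h
  -- the local condition for `Γ(1) = SL₂(ℤ)` by the divisor induction with `d = N`, `c = 1`
  have hloc := local_Gamma_of_squarefree hN hℓ ((powMonoidHom m).comp θ) (hinv m) he N 1 (mul_one N).symm
  refine hloc x hx ?_
  rw [Gamma_one_top]
  have hxc : x ∈ commutator SL(2, ℤ) :=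
    (Subgroup.mem_inf.mp (Literature.NumberTheory.ModularForms.SL2Z.Gamma_mul_le_inf_commutator N hx12)).2
  exact Subgroup.mem_sup_left hxc

/-- **Squarefree level, in the exact shape of `stub_hcor_invariant`** (restricted to squarefree `N`): `M = 12N`.
K★ / Manin / BSD are NOT proved by this. [cite: CalegariDimitrovTang2025, Corollary 4.5.3] -/
theorem stub_hcor_invariant_squarefree {N : ℕ} (hN : Squarefree N) (Q : Type) [CommGroup Q] [Finite Q]
    (θ : Gamma N →* Q)
    (hθ : ∀ (g x : SL(2, ℤ)) (hx : x ∈ Gamma N) (hgx : g * x * g⁻¹ ∈ Gamma N),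
      θ ⟨g * x * g⁻¹, hgx⟩ = θ ⟨x, hx⟩) :
    ∃ M : ℕ, M ≠ 0 ∧ ∀ (x : SL(2, ℤ)) (hx : x ∈ Gamma N), x ∈ Gamma M → θ ⟨x, hx⟩ = 1 :=
  ⟨12 * N, Nat.mul_ne_zero (by norm_num) (Squarefree.ne_zero hN), cor453_invariant_form_squarefree hN Q θ hθ⟩

/-- Equivalently: **`[SL₂(ℤ), Γ(N)] ⊇ Γ(12N)` for squarefree `N`** (apply the previous theorem to the
universal invariant homomorphism `Γ(N) → Γ(N)ᵃᵇ/image of [SL₂(ℤ), Γ(N)]`, whose target is finite).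
[cite: Beyl1986, Theorem] [cite: CalegariDimitrovTang2025, Corollary 4.5.3] -/
theorem Gamma_mul_le_commutator_of_squarefree {N : ℕ} (hN : Squarefree N) :
    Gamma (12 * N) ≤ ⁅(⊤ : Subgroup SL(2, ℤ)), Gamma N⁆ := by
  classical
  haveI : NeZero N := ⟨Squarefree.ne_zero hN⟩
  let K' : Subgroup (Gamma N) := (⁅(⊤ : Subgroup SL(2, ℤ)), Gamma N⁆).subgroupOf (Gamma N)
  obtain ⟨B, hinv0, hθ₀⟩ := exists_universal_invariant_hom N
  let θ₀ : Gamma N →* Abelianization (Gamma N) ⧸ B := (QuotientGroup.mk' B).comp Abelianization.of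
  have hsurj : Function.Surjective θ₀ :=
    (QuotientGroup.mk'_surjective B).comp QuotientGroup.mk_surjective
  haveI := finiteIndex_commutator_top_Gamma N
  have hK'fin : K'.index ≠ 0 := by
    intro h0
    have h := Subgroup.relIndex_mul_index
      (show ⁅(⊤ : Subgroup SL(2, ℤ)), Gamma N⁆ ≤ Gamma N from
        Subgroup.commutator_le_right _ _ (h := Gamma_normal N))
    rw [Subgroup.relIndex, show (⁅(⊤ : Subgroup SL(2, ℤ)), Gamma N⁆.subgroupOf (Gamma N)).index = 0
      from h0, zero_mul] at h
    exact Subgroup.FiniteIndex.index_ne_zero h.symm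
  have hker : θ₀.ker = K' := by
    ext x
    rw [MonoidHom.mem_ker, hθ₀, Subgroup.mem_subgroupOf]
  haveI : Finite (Abelianization (Gamma N) ⧸ B) := by
    have hcard : Nat.card (Abelianization (Gamma N) ⧸ B) = K'.index := by
      rw [← hker, Subgroup.index_ker, MonoidHom.range_eq_top.mpr hsurj, Subgroup.card_top]
    exact Nat.finite_of_card_ne_zero (hcard ▸ hK'fin)
  intro x hx12
  have hx : x ∈ Gamma N :=
    (Subgroup.mem_inf.mp (Literature.NumberTheory.ModularForms.SL2Z.Gamma_mul_le_inf_commutator N hx12)).1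
  exact (hθ₀ ⟨x, hx⟩).mp (cor453_invariant_form_squarefree hN _ θ₀ hinv0 x hx hx12)

end HcorSquarefree

end Summit.BirchSwinnertonDyer.BirchSwinnertonDyer.Theorems
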